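import Summits.Ventures.Crystal3D.Theorems.StickyWulffConstantGenericWallFloorChainLedger
import Summits.Ventures.Crystal3D.Theorems.StickyWulffConstantGenericWallFloorCreditLedger
import Summits.Ventures.Crystal3D.Theorems.StickyWulffConstantGenericWallFloorStarLemma
import Summits.Ventures.Crystal3D.Theorems.StickyWulffConstantCoaxialWallLawExitCountBelow
import HarnessLib

/-!
# N-TC, sharpened: the chain ledger with the double-top residual cut down to DEGREE-11 coincidence
# double tops — and NO double-top residual at all for antipodal walk slots (`A₁u₁ + A₂u₂ = 0`)

HONEST FRAMING. Part of the venture `Summits/Ventures/Crystal3D` (cell `crystal3d-full`), helper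
`--supports` the crux `GenericWallFloor` (stmt-Ventures-19480) of `route-Ventures-StickyWulffConstant`,
registered line `WallLedgerG`, open stub `stub_twoSlabAdhesion`.  Sequel of `…ChainLedger`
(`twoSlabAdhesion_chainLedger`, cf-p1 ROUTE §81(3)/(7) N-TC): same statement, built on the WEIGHTED
ledger `ledger_ge_faces_add_credits` (…CreditLedger: a payer is credited `12 − deg`), so a ball claimed by
both line families pays both claims as soon as its degree is `≤ 10`.

* **`twoSlabAdhesion_chainLedger'`** — as `twoSlabAdhesion_chainLedger` with `#DT` replaced by `#DT₁₁`,
  the coincidence-site double tops (unsaturated lattice exits of BOTH grains, on `Λ₁ ∩ Λ₂`) of degree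
  EXACTLY `11`.  (cf-p1 g24's double-star census, kit j292323: numerically `DT₁₁ = ∅` for every
  non-co-axial pair, margin → 0 only at the Σ3-twin limit — an algebraic lemma is wanted for the tilted
  case; the antipodal case is the star lemma.)
* **`twoSlabAdhesion_chainLedger_antipodal`** — if the two walk slots are ANTIPODAL (`A₁ u₁ + A₂ u₂ = 0`:
  both grains share the steep slot line, e.g. every pair with a common steepest slot, the `[110]`-twist
  walls) then `DT₁₁ = ∅` by `card_neighbours_le_ten_of_antipodal_stars` (…StarLemma), and the wall floor
  holds at full charge `½(κ₁ + κ₂) = κ₁ ≥ 1` modulo ONLY the E1 row `ExactOnly`(C12-55) and the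
  twin-capped lattice exits `#TC₁ + #TC₂`.

WHAT THIS IS NOT: not the stub (`ExactOnly` C12-55 outside-tube = R39c is an input; `#TC` — junk
cappers / stacks — is the residual of record; clean slivers assumed); F-C1 not moved.
-/

noncomputable section

namespace Summit.Ventures.Crystal3D.Theorems

open Summit.Ventures.Crystal3D Finset
open Literature.MathematicalPhysics.StatisticalMechanics (fccStacking contactDeficiency)
open scoped InnerProductSpace

open scoped Classical in
/-- **The chain ledger with degree-11 double tops only.**  See the module docstring. -/
theorem twoSlabAdhesion_chainLedger'
    {s₀ : EuclideanSpace ℝ (Fin 3)} (hs₀ : s₀ ∈ fccSlots)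
    (hcert : ExactOnly 0 (fccSlots.filter fun w => 0 < ⟪w, s₀⟫_ℝ))
    (A₁ : EuclideanSpace ℝ (Fin 3) ≃ₗᵢ[ℝ] EuclideanSpace ℝ (Fin 3)) (t₁ : EuclideanSpace ℝ (Fin 3))
    (A₂ : EuclideanSpace ℝ (Fin 3) ≃ₗᵢ[ℝ] EuclideanSpace ℝ (Fin 3)) (t₂ : EuclideanSpace ℝ (Fin 3))
    (hA₁₂ : ¬ ∀ w ∈ fccSlots, A₁ w ∈ A₂ '' fccStacking 1 (Real.sqrt (2 / 3)))
    (hA₂₁ : ¬ ∀ w ∈ fccSlots, A₂ w ∈ A₁ '' fccStacking 1 (Real.sqrt (2 / 3)))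
    {u₁ : EuclideanSpace ℝ (Fin 3)} (hu₁ : u₁ ∈ fccSlots)
    (hsteep₁ : Real.sqrt 2 / 2 ≤ ⟪A₁ u₁, EuclideanSpace.single (2 : Fin 3) (1 : ℝ)⟫_ℝ)
    {u₂ : EuclideanSpace ℝ (Fin 3)} (hu₂ : u₂ ∈ fccSlots)
    (hsteep₂ : ⟪A₂ u₂, EuclideanSpace.single (2 : Fin 3) (1 : ℝ)⟫_ℝ ≤ -(Real.sqrt 2 / 2)) :
    ∃ C R₀ : ℝ, 1 ≤ R₀ ∧ ∀ h : ℝ, 0 ≤ h → ∀ ρ : ℝ, R₀ ≤ ρ →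
      ∀ X P₁ P₂ : Finset (EuclideanSpace ℝ (Fin 3)),
      (∀ p ∈ X, ∀ q ∈ X, p ≠ q → 1 ≤ dist p q) → P₁ ⊆ X → P₂ ⊆ X \ P₁ →
      (∀ p ∈ X, -(2 * R₀) ≤ p 2 ∧ p 2 ≤ h + 2 * R₀ ∧ p 0 ^ 2 + p 1 ^ 2 ≤ ρ ^ 2) →
      (∀ p, p ∈ P₁ ↔ (p ∈ (fun q => A₁ q + t₁) '' fccStacking 1 (Real.sqrt (2 / 3)) ∧
        -(2 * R₀) ≤ p 2 ∧ p 2 ≤ -R₀ ∧ p 0 ^ 2 + p 1 ^ 2 ≤ ρ ^ 2)) →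
      (∀ p, p ∈ P₂ ↔ (p ∈ (fun q => A₂ q + t₂) '' fccStacking 1 (Real.sqrt (2 / 3)) ∧
        h + R₀ ≤ p 2 ∧ p 2 ≤ h + 2 * R₀ ∧ p 0 ^ 2 + p 1 ^ 2 ≤ ρ ^ 2)) →
      -- CLEAN outer slivers
      (∀ p ∈ X, p 2 < -(2 * R₀) + 1 → p ∈ (fun q => A₁ q + t₁) '' fccStacking 1 (Real.sqrt (2 / 3))) →
      (∀ p ∈ X, h + 2 * R₀ - 1 < p 2 → p ∈ (fun q => A₂ q + t₂) '' fccStacking 1 (Real.sqrt (2 / 3))) →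
      ((((P₁ ×ˢ (X \ P₁)).filter fun pq => dist pq.1 pq.2 = 1).card : ℕ) : ℝ) +
        ((((P₂ ×ˢ ((X \ P₁) \ P₂)).filter fun pq => dist pq.1 pq.2 = 1).card : ℕ) : ℝ) ≤
        contactDeficiency ((X \ P₁) \ P₂) +
          (Real.sqrt 2 / 4 * ∑ᶠ w ∈ {w ∈ fccStacking 1 (Real.sqrt (2 / 3)) | ‖w‖ = 1},
              |⟪w, A₁.symm (EuclideanSpace.single (2 : Fin 3) (1 : ℝ))⟫_ℝ| +
            Real.sqrt 2 / 4 * ∑ᶠ w ∈ {w ∈ fccStacking 1 (Real.sqrt (2 / 3)) | ‖w‖ = 1},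
              |⟪w, A₂.symm (EuclideanSpace.single (2 : Fin 3) (1 : ℝ))⟫_ℝ| -
            (Real.sqrt 2 * |⟪A₁ u₁, EuclideanSpace.single (2 : Fin 3) (1 : ℝ)⟫_ℝ| +
              Real.sqrt 2 * |⟪A₂ u₂, EuclideanSpace.single (2 : Fin 3) (1 : ℝ)⟫_ℝ|) / 2) * Real.pi * ρ ^ 2 +
          (((((X.filter fun e => e ∈ (fun q => A₁ q + t₁) '' fccStacking 1 (Real.sqrt (2 / 3)) ∧
                e - A₁ u₁ ∈ X ∧ (∀ w ∈ fccSlots, e - A₁ u₁ + A₁ w ∈ X) ∧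
                ∃ v ∈ fccSlots, e + A₁ v ∉ X).filter fun e => ∃ n : EuclideanSpace ℝ (Fin 3), ‖n‖ = 1 ∧
              (∀ w ∈ fccSlots, ⟪A₁ w, n⟫_ℝ = 0 ∨ ⟪A₁ w, n⟫_ℝ = Real.sqrt (2 / 3) ∨
                ⟪A₁ w, n⟫_ℝ = -Real.sqrt (2 / 3)) ∧
              ⟪A₁ u₁, n⟫_ℝ = Real.sqrt (2 / 3) ∧
              (∀ w ∈ fccSlots, ⟪A₁ w, n⟫_ℝ ≤ 0 → e + A₁ w ∈ X) ∧
              (∀ w ∈ fccSlots, 0 < ⟪A₁ w, n⟫_ℝ → e + A₁ w ∉ X ∧ e - A₁ w + (2 * ⟪A₁ w, n⟫_ℝ) • n ∈ X)).card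
              : ℕ) : ℝ) +
           ((((X.filter fun e => e ∈ (fun q => A₂ q + t₂) '' fccStacking 1 (Real.sqrt (2 / 3)) ∧
                e - A₂ u₂ ∈ X ∧ (∀ w ∈ fccSlots, e - A₂ u₂ + A₂ w ∈ X) ∧
                ∃ v ∈ fccSlots, e + A₂ v ∉ X).filter fun e => ∃ n : EuclideanSpace ℝ (Fin 3), ‖n‖ = 1 ∧
              (∀ w ∈ fccSlots, ⟪A₂ w, n⟫_ℝ = 0 ∨ ⟪A₂ w, n⟫_ℝ = Real.sqrt (2 / 3) ∨
                ⟪A₂ w, n⟫_ℝ = -Real.sqrt (2 / 3)) ∧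
              ⟪A₂ u₂, n⟫_ℝ = Real.sqrt (2 / 3) ∧
              (∀ w ∈ fccSlots, ⟪A₂ w, n⟫_ℝ ≤ 0 → e + A₂ w ∈ X) ∧
              (∀ w ∈ fccSlots, 0 < ⟪A₂ w, n⟫_ℝ → e + A₂ w ∉ X ∧ e - A₂ w + (2 * ⟪A₂ w, n⟫_ℝ) • n ∈ X)).card
              : ℕ) : ℝ) +
           (((X.filter fun e => e ∈ (fun q => A₁ q + t₁) '' fccStacking 1 (Real.sqrt (2 / 3)) ∧
                e ∈ (fun q => A₂ q + t₂) '' fccStacking 1 (Real.sqrt (2 / 3)) ∧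
                (X.filter fun q => dist e q = 1).card = 11 ∧
                (e - A₁ u₁ ∈ X ∧ (∀ w ∈ fccSlots, e - A₁ u₁ + A₁ w ∈ X) ∧ ∃ v ∈ fccSlots, e + A₁ v ∉ X) ∧
                (e - A₂ u₂ ∈ X ∧ (∀ w ∈ fccSlots, e - A₂ u₂ + A₂ w ∈ X) ∧ ∃ v ∈ fccSlots, e + A₂ v ∉ X)).card
              : ℕ) : ℝ)) / 2 +
          C * (1 + h) * ρ := by
  obtain ⟨C₁, hC₁⟩ := affineSampleDeficit_upper A₁ t₁ 10 (by norm_num)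
  obtain ⟨C₂, hC₂⟩ := affineSampleDeficit_upper A₂ t₂ 10 (by norm_num)
  refine ⟨(240 * Real.sqrt 2 * Real.pi + 5760 * (4 * 10 + 2)) / 2 + 100 + |C₁| + |C₂|, 10, by norm_num, ?_⟩
  intro h hh ρ hρ X P₁ P₂ hX hP₁X hP₂X hcell hP₁ hP₂ hclean₁ hclean₂
  set e₃ : EuclideanSpace ℝ (Fin 3) := EuclideanSpace.single (2 : Fin 3) (1 : ℝ) with he₃
  set φ₁ : ℝ := Real.sqrt 2 / 4 * ∑ᶠ w ∈ {w ∈ fccStacking 1 (Real.sqrt (2 / 3)) | ‖w‖ = 1},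
      |⟪w, A₁.symm e₃⟫_ℝ| with hφ₁
  set φ₂ : ℝ := Real.sqrt 2 / 4 * ∑ᶠ w ∈ {w ∈ fccStacking 1 (Real.sqrt (2 / 3)) | ‖w‖ = 1},
      |⟪w, A₂.symm e₃⟫_ℝ| with hφ₂
  set Λ₁ : Set (EuclideanSpace ℝ (Fin 3)) := (fun q => A₁ q + t₁) '' fccStacking 1 (Real.sqrt (2 / 3)) with hΛ₁
  set Λ₂ : Set (EuclideanSpace ℝ (Fin 3)) := (fun q => A₂ q + t₂) '' fccStacking 1 (Real.sqrt (2 / 3)) with hΛ₂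
  have hP₂X' : P₂ ⊆ X := hP₂X.trans Finset.sdiff_subset
  have hρ0 : (0 : ℝ) ≤ ρ := by linarith
  -- the exit predicates and the sets of the statement
  set EX₁ : EuclideanSpace ℝ (Fin 3) → Prop := fun e =>
    e - A₁ u₁ ∈ X ∧ (∀ w ∈ fccSlots, e - A₁ u₁ + A₁ w ∈ X) ∧ ∃ v ∈ fccSlots, e + A₁ v ∉ X with hEX₁
  set EX₂ : EuclideanSpace ℝ (Fin 3) → Prop := fun e =>
    e - A₂ u₂ ∈ X ∧ (∀ w ∈ fccSlots, e - A₂ u₂ + A₂ w ∈ X) ∧ ∃ v ∈ fccSlots, e + A₂ v ∉ X with hEX₂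
  set TW₁ : EuclideanSpace ℝ (Fin 3) → Prop := fun e => ∃ n : EuclideanSpace ℝ (Fin 3), ‖n‖ = 1 ∧
    (∀ w ∈ fccSlots, ⟪A₁ w, n⟫_ℝ = 0 ∨ ⟪A₁ w, n⟫_ℝ = Real.sqrt (2 / 3) ∨ ⟪A₁ w, n⟫_ℝ = -Real.sqrt (2 / 3)) ∧
    ⟪A₁ u₁, n⟫_ℝ = Real.sqrt (2 / 3) ∧ (∀ w ∈ fccSlots, ⟪A₁ w, n⟫_ℝ ≤ 0 → e + A₁ w ∈ X) ∧
    (∀ w ∈ fccSlots, 0 < ⟪A₁ w, n⟫_ℝ → e + A₁ w ∉ X ∧ e - A₁ w + (2 * ⟪A₁ w, n⟫_ℝ) • n ∈ X) with hTW₁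
  set TW₂ : EuclideanSpace ℝ (Fin 3) → Prop := fun e => ∃ n : EuclideanSpace ℝ (Fin 3), ‖n‖ = 1 ∧
    (∀ w ∈ fccSlots, ⟪A₂ w, n⟫_ℝ = 0 ∨ ⟪A₂ w, n⟫_ℝ = Real.sqrt (2 / 3) ∨ ⟪A₂ w, n⟫_ℝ = -Real.sqrt (2 / 3)) ∧
    ⟪A₂ u₂, n⟫_ℝ = Real.sqrt (2 / 3) ∧ (∀ w ∈ fccSlots, ⟪A₂ w, n⟫_ℝ ≤ 0 → e + A₂ w ∈ X) ∧
    (∀ w ∈ fccSlots, 0 < ⟪A₂ w, n⟫_ℝ → e + A₂ w ∉ X ∧ e - A₂ w + (2 * ⟪A₂ w, n⟫_ℝ) • n ∈ X) with hTW₂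
  set deg : EuclideanSpace ℝ (Fin 3) → ℕ := fun x => (X.filter fun q => dist x q = 1).card with hdeg
  set LEX₁ := X.filter fun e => e ∈ Λ₁ ∧ EX₁ e with hLEX₁
  set LEX₂ := X.filter fun e => e ∈ Λ₂ ∧ EX₂ e with hLEX₂
  set TC₁ := LEX₁.filter fun e => TW₁ e with hTC₁
  set TC₂ := LEX₂.filter fun e => TW₂ e with hTC₂
  set DT := X.filter fun e => e ∈ Λ₁ ∧ e ∈ Λ₂ ∧ deg e = 11 ∧ EX₁ e ∧ EX₂ e with hDT
  set U₁ := LEX₁.filter fun e => deg e ≠ 12 with hU₁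
  set U₂ := LEX₂.filter fun e => deg e ≠ 12 with hU₂
  -- the ledger with payers
  have hled := ledger_ge_faces_add_credits A₁ t₁ A₂ t₂ X P₁ P₂ 10 h ρ le_rfl hh hρ hX hcell hP₁X hP₂X' hP₁ hP₂
    hclean₁ hclean₂ hA₁₂ hA₂₁ hu₁ hsteep₁ hu₂ hsteep₂
  rw [← finsum_unit_fcc_symm_eq_sum_slots A₁, ← finsum_unit_fcc_symm_eq_sum_slots A₂, ← hφ₁, ← hφ₂] at hled
  set PAY := X.filter fun y => (X.filter fun q => dist y q = 1).card ≠ 12 ∧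
    ((∃ e ∈ X, (e - A₁ u₁ ∈ X ∧ (∀ w ∈ fccSlots, e - A₁ u₁ + A₁ w ∈ X) ∧ ∃ v ∈ fccSlots, e + A₁ v ∉ X) ∧
        (y = e ∨ dist e y = 1 ∨ (∃ z ∈ X, dist e z = 1 ∧ dist z y = 1) ∨
          ∃ z ∈ X, ∃ z' ∈ X, dist e z = 1 ∧ dist z z' = 1 ∧ dist z' y = 1)) ∨
      (∃ e ∈ X, (e - A₂ u₂ ∈ X ∧ (∀ w ∈ fccSlots, e - A₂ u₂ + A₂ w ∈ X) ∧ ∃ v ∈ fccSlots, e + A₂ v ∉ X) ∧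
        (y = e ∨ dist e y = 1 ∨ (∃ z ∈ X, dist e z = 1 ∧ dist z y = 1) ∨
          ∃ z ∈ X, ∃ z' ∈ X, dist e z = 1 ∧ dist z z' = 1 ∧ dist z' y = 1))) with hPAY
  -- unsaturated lattice exits are payers
  have hU₁P : U₁ ⊆ PAY := by
    intro y hy
    rw [hU₁, mem_filter, hLEX₁, mem_filter] at hy
    obtain ⟨⟨hyX, -, hyE⟩, hyd⟩ := hy
    rw [hPAY, mem_filter]
    exact ⟨hyX, hyd, Or.inl ⟨y, hyX, hyE, Or.inl rfl⟩⟩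
  have hU₂P : U₂ ⊆ PAY := by
    intro y hy
    rw [hU₂, mem_filter, hLEX₂, mem_filter] at hy
    obtain ⟨⟨hyX, -, hyE⟩, hyd⟩ := hy
    rw [hPAY, mem_filter]
    exact ⟨hyX, hyd, Or.inr ⟨y, hyX, hyE, Or.inl rfl⟩⟩
  have hdeg12 : ∀ x, deg x ≤ 12 := fun x => card_filter_dist_eq_one_le_twelve X hX x
  -- the weighted payer sum dominates `#U₁ + #U₂ − #DT`
  have hUU : ∀ y ∈ U₁ ∩ U₂, deg y = 11 → y ∈ DT := by
    intro y hy h11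
    have hy₁ : y ∈ U₁ := (mem_inter.1 hy).1
    have hy₂ : y ∈ U₂ := (mem_inter.1 hy).2
    rw [hU₁, mem_filter, hLEX₁, mem_filter] at hy₁
    rw [hU₂, mem_filter, hLEX₂, mem_filter] at hy₂
    obtain ⟨⟨hyX, hyΛ₁, hyE₁⟩, -⟩ := hy₁
    obtain ⟨⟨-, hyΛ₂, hyE₂⟩, -⟩ := hy₂
    rw [hDT, mem_filter]
    exact ⟨hyX, hyΛ₁, hyΛ₂, h11, hyE₁, hyE₂⟩
  have hPAYge : (U₁.card : ℝ) + U₂.card - DT.card ≤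
      ∑ y ∈ PAY, ((12 : ℝ) - ((X.filter fun q => dist y q = 1).card : ℝ)) := by
    show (U₁.card : ℝ) + U₂.card - DT.card ≤ ∑ y ∈ PAY, ((12 : ℝ) - (deg y : ℝ))
    -- per ball of `U₁ ∪ U₂`: indicator(U₁) + indicator(U₂) − indicator(DT) ≤ 12 − deg
    have hpt : ∀ y ∈ U₁ ∪ U₂, ((if y ∈ U₁ then (1 : ℝ) else 0) + (if y ∈ U₂ then (1 : ℝ) else 0) -
        (if y ∈ DT then (1 : ℝ) else 0)) ≤ (12 : ℝ) - (deg y : ℝ) := by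
      intro y hy
      have hne : deg y ≠ 12 := by
        rcases mem_union.1 hy with h | h
        · exact (mem_filter.1 h).2
        · exact (mem_filter.1 h).2
      have hle : deg y ≤ 11 := by have := hdeg12 y; omega
      have h11r : (deg y : ℝ) ≤ 11 := by exact_mod_cast hle
      by_cases hb : y ∈ U₁ ∧ y ∈ U₂
      · rw [if_pos hb.1, if_pos hb.2]
        by_cases h11 : deg y = 11
        · rw [if_pos (hUU y (mem_inter.2 hb) h11), h11]; norm_num
        · have : (deg y : ℝ) ≤ 10 := by exact_mod_cast (by omega : deg y ≤ 10)
          have h0 : (0 : ℝ) ≤ (if y ∈ DT then (1 : ℝ) else 0) := by split_ifs <;> norm_num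
          linarith
      · have h0 : (0 : ℝ) ≤ (if y ∈ DT then (1 : ℝ) else 0) := by split_ifs <;> norm_num
        have h2 : (if y ∈ U₁ then (1 : ℝ) else 0) + (if y ∈ U₂ then (1 : ℝ) else 0) ≤ 1 := by
          rw [not_and_or] at hb
          rcases hb with h | h
          · rw [if_neg h]; split_ifs <;> norm_num
          · rw [if_neg h]; split_ifs <;> norm_num
        linarith
    have hsum := sum_le_sum hpt
    rw [sum_sub_distrib, sum_add_distrib] at hsum
    have e1 : ∑ y ∈ U₁ ∪ U₂, (if y ∈ U₁ then (1 : ℝ) else 0) = U₁.card := by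
      rw [sum_boole, filter_mem_eq_inter, inter_eq_right.2 subset_union_left]
    have e2 : ∑ y ∈ U₁ ∪ U₂, (if y ∈ U₂ then (1 : ℝ) else 0) = U₂.card := by
      rw [sum_boole, filter_mem_eq_inter, inter_eq_right.2 subset_union_right]
    have e3 : ∑ y ∈ U₁ ∪ U₂, (if y ∈ DT then (1 : ℝ) else 0) ≤ DT.card := by
      rw [sum_boole]
      have hsubDT : ((U₁ ∪ U₂).filter fun y => y ∈ DT) ⊆ DT := fun y hy => (mem_filter.1 hy).2
      exact_mod_cast card_le_card hsubDT
    have e4 : ∑ y ∈ U₁ ∪ U₂, ((12 : ℝ) - (deg y : ℝ)) ≤ ∑ y ∈ PAY, ((12 : ℝ) - (deg y : ℝ)) :=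
      sum_le_sum_of_subset_of_nonneg (union_subset hU₁P hU₂P) fun y _ _ => by
        have : (deg y : ℝ) ≤ 12 := by exact_mod_cast hdeg12 y
        linarith
    linarith
  -- every lattice exit is unsaturated or twin-capped
  have hLEX₁le : LEX₁.card ≤ U₁.card + TC₁.card := by
    refine (card_le_card ?_).trans (card_union_le U₁ TC₁)
    intro e he
    have he' := he
    rw [hLEX₁, mem_filter] at he'
    obtain ⟨heX, -, hd, hfull, hv⟩ := he'
    rcases exit_unsaturated_or_twinCap hX hs₀ hcert A₁ hu₁ hd hfull hv with h11 | htw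
    · exact mem_union_left _ (mem_filter.2 ⟨he, by
        change (X.filter fun q => dist e q = 1).card ≠ 12; omega⟩)
    · exact mem_union_right _ (mem_filter.2 ⟨he, htw⟩)
  have hLEX₂le : LEX₂.card ≤ U₂.card + TC₂.card := by
    refine (card_le_card ?_).trans (card_union_le U₂ TC₂)
    intro e he
    have he' := he
    rw [hLEX₂, mem_filter] at he'
    obtain ⟨heX, -, hd, hfull, hv⟩ := he'
    rcases exit_unsaturated_or_twinCap hX hs₀ hcert A₂ hu₂ hd hfull hv with h11 | htw
    · exact mem_union_left _ (mem_filter.2 ⟨he, by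
        change (X.filter fun q => dist e q = 1).card ≠ 12; omega⟩)
    · exact mem_union_right _ (mem_filter.2 ⟨he, htw⟩)
  -- sources: lattice exits are at least a flux (19481-p2's lattice form of `card_exits_ge_window`)
  have hP₁w : ∀ p, p ∈ P₁ ↔ (p ∈ (fun q => A₁ q + t₁) '' fccStacking 1 (Real.sqrt (2 / 3)) ∧
      (-(2 * 10)) ≤ p 2 ∧ p 2 ≤ (-(2 * 10)) + 10 ∧ p 0 ^ 2 + p 1 ^ 2 ≤ ρ ^ 2) := by
    intro p; rw [hP₁ p, show -(2 * 10) + (10 : ℝ) = -10 by ring]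
  have hEX₁ := card_lattice_exits_ge_window A₁ t₁ X P₁ (-(2 * 10)) 10 ρ (by norm_num) hρ hP₁X hP₁w hu₁
  have hP₂w : ∀ p, p ∈ P₂ ↔ (p ∈ (fun q => A₂ q + t₂) '' fccStacking 1 (Real.sqrt (2 / 3)) ∧
      (h + 10) ≤ p 2 ∧ p 2 ≤ (h + 10) + 10 ∧ p 0 ^ 2 + p 1 ^ 2 ≤ ρ ^ 2) := by
    intro p; rw [hP₂ p, show h + 10 + 10 = h + 2 * 10 by ring]
  have hEX₂ := card_lattice_exits_ge_window A₂ t₂ X P₂ (h + 10) 10 ρ (by norm_num) hρ hP₂X' hP₂w hu₂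
  have hEX₁' : Real.sqrt 2 * |⟪A₁ u₁, e₃⟫_ℝ| * Real.pi * (ρ - 1) ^ 2 - 10 * Real.sqrt 2 * Real.pi * (ρ - 1) ≤
      (LEX₁.card : ℝ) := by convert hEX₁ using 3
  have hEX₂' : Real.sqrt 2 * |⟪A₂ u₂, e₃⟫_ℝ| * Real.pi * (ρ - 1) ^ 2 - 10 * Real.sqrt 2 * Real.pi * (ρ - 1) ≤
      (LEX₂.card : ℝ) := by convert hEX₂ using 3
  have hL₁ : (LEX₁.card : ℝ) ≤ U₁.card + TC₁.card := by exact_mod_cast hLEX₁le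
  have hL₂ : (LEX₂.card : ℝ) ≤ U₂.card + TC₂.card := by exact_mod_cast hLEX₂le
  -- fluxes `κᵢ ∈ [0, √2]`
  set κ₁ : ℝ := Real.sqrt 2 * |⟪A₁ u₁, e₃⟫_ℝ| with hκ₁
  set κ₂ : ℝ := Real.sqrt 2 * |⟪A₂ u₂, e₃⟫_ℝ| with hκ₂
  have hsq : 0 ≤ Real.sqrt 2 := Real.sqrt_nonneg 2
  have hs2' : Real.sqrt 2 ≤ 2 := by
    rw [show (2 : ℝ) = Real.sqrt (2 ^ 2) by rw [Real.sqrt_sq (by norm_num)]]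
    exact Real.sqrt_le_sqrt (by norm_num)
  have hκ₁0 : 0 ≤ κ₁ := mul_nonneg hsq (abs_nonneg _)
  have hκ₂0 : 0 ≤ κ₂ := mul_nonneg hsq (abs_nonneg _)
  have hκ₁2 : κ₁ ≤ 2 := by
    have := abs_inner_slot_le_one A₁ hu₁
    calc κ₁ = Real.sqrt 2 * |⟪A₁ u₁, e₃⟫_ℝ| := rfl
      _ ≤ 2 * 1 := mul_le_mul hs2' this (abs_nonneg _) (by norm_num)
      _ = 2 := by ring
  have hκ₂2 : κ₂ ≤ 2 := by
    have := abs_inner_slot_le_one A₂ hu₂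
    calc κ₂ = Real.sqrt 2 * |⟪A₂ u₂, e₃⟫_ℝ| := rfl
      _ ≤ 2 * 1 := mul_le_mul hs2' this (abs_nonneg _) (by norm_num)
      _ = 2 := by ring
  -- the two upper slab counts and the two splits
  have hD₁ := hC₁ (-(2 * 10)) (-10) (by ring) ρ hρ P₁ hP₁
  have hD₂ := hC₂ (h + 10) (h + 2 * 10) (by ring) ρ hρ P₂ hP₂
  have hsplit₁ := contactDeficiency_sdiff_split hP₁X
  have hsplit₂ := contactDeficiency_sdiff_split hP₂X
  have htwo := two_mul_contactDeficiency_eq_sum X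
  -- constants
  have hb : C₁ * ρ ≤ |C₁| * (1 + h) * ρ := by
    have h1 : 0 ≤ (|C₁| - C₁) * ρ := mul_nonneg (by linarith only [le_abs_self C₁]) hρ0
    have h2 : 0 ≤ |C₁| * h * ρ := by positivity
    linarith only [h1, h2]
  have hc' : C₂ * ρ ≤ |C₂| * (1 + h) * ρ := by
    have h1 : 0 ≤ (|C₂| - C₂) * ρ := mul_nonneg (by linarith only [le_abs_self C₂]) hρ0
    have h2 : 0 ≤ |C₂| * h * ρ := by positivity
    linarith only [h1, h2]
  have hπ : Real.pi ≤ 4 := Real.pi_le_four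
  have hπ0 : 0 ≤ Real.pi := Real.pi_pos.le
  -- `κ π (ρ−1)² − 10√2 π (ρ−1) ≥ κ π ρ² − 100 (1+h) ρ` for `κ ∈ [0, 2]`
  have hkey : ∀ κ : ℝ, 0 ≤ κ → κ ≤ 2 →
      κ * Real.pi * ρ ^ 2 - 100 * (1 + h) * ρ ≤ κ * Real.pi * (ρ - 1) ^ 2 - 10 * Real.sqrt 2 * Real.pi * (ρ - 1) := by
    intro κ hκ0 hκ2
    have e : κ * Real.pi * (ρ - 1) ^ 2 - 10 * Real.sqrt 2 * Real.pi * (ρ - 1) - (κ * Real.pi * ρ ^ 2 - 100 * (1 + h) * ρ)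
        = (100 * ρ - 2 * (κ * Real.pi * ρ) - 10 * (Real.sqrt 2 * Real.pi * ρ)) + 100 * (h * ρ) + κ * Real.pi +
          10 * (Real.sqrt 2 * Real.pi) := by ring
    have h1 : 0 ≤ h * ρ := mul_nonneg hh hρ0
    have h2 : 0 ≤ Real.sqrt 2 * Real.pi := mul_nonneg hsq hπ0
    have h3 : κ * Real.pi * ρ ≤ 8 * ρ := by
      have : κ * Real.pi ≤ 2 * 4 := mul_le_mul hκ2 hπ hπ0 (by norm_num)
      exact (mul_le_mul_of_nonneg_right this hρ0).trans (by linarith)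
    have h4 : Real.sqrt 2 * Real.pi * ρ ≤ 8 * ρ := by
      have : Real.sqrt 2 * Real.pi ≤ 8 := by nlinarith only [hπ, hπ0, hsq, hs2']
      exact mul_le_mul_of_nonneg_right this hρ0
    have h5 : 0 ≤ κ * Real.pi := mul_nonneg hκ0 hπ0
    linarith only [e, h1, h2, h3, h4, h5, hρ0]
  have hkey₁ := hkey κ₁ hκ₁0 hκ₁2
  have hkey₂ := hkey κ₂ hκ₂0 hκ₂2
  have hhρ : 0 ≤ h * ρ := mul_nonneg hh hρ0
  linarith only [hled, hEX₁', hEX₂', hPAYge, hL₁, hL₂, hD₁, hD₂, hsplit₁, hsplit₂, htwo, hb, hc', hkey₁, hkey₂,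
    hρ0, hh, hhρ, hπ0]

open scoped Classical in
/-- **The chain ledger for ANTIPODAL walk slots: no double-top residual.**  See the module docstring. -/
theorem twoSlabAdhesion_chainLedger_antipodal
    {s₀ : EuclideanSpace ℝ (Fin 3)} (hs₀ : s₀ ∈ fccSlots)
    (hcert : ExactOnly 0 (fccSlots.filter fun w => 0 < ⟪w, s₀⟫_ℝ))
    (A₁ : EuclideanSpace ℝ (Fin 3) ≃ₗᵢ[ℝ] EuclideanSpace ℝ (Fin 3)) (t₁ : EuclideanSpace ℝ (Fin 3))
    (A₂ : EuclideanSpace ℝ (Fin 3) ≃ₗᵢ[ℝ] EuclideanSpace ℝ (Fin 3)) (t₂ : EuclideanSpace ℝ (Fin 3))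
    (hA₁₂ : ¬ ∀ w ∈ fccSlots, A₁ w ∈ A₂ '' fccStacking 1 (Real.sqrt (2 / 3)))
    (hA₂₁ : ¬ ∀ w ∈ fccSlots, A₂ w ∈ A₁ '' fccStacking 1 (Real.sqrt (2 / 3)))
    {u₁ : EuclideanSpace ℝ (Fin 3)} (hu₁ : u₁ ∈ fccSlots)
    (hsteep₁ : Real.sqrt 2 / 2 ≤ ⟪A₁ u₁, EuclideanSpace.single (2 : Fin 3) (1 : ℝ)⟫_ℝ)
    {u₂ : EuclideanSpace ℝ (Fin 3)} (hu₂ : u₂ ∈ fccSlots)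
    (hsteep₂ : ⟪A₂ u₂, EuclideanSpace.single (2 : Fin 3) (1 : ℝ)⟫_ℝ ≤ -(Real.sqrt 2 / 2))
    (hanti : A₁ u₁ + A₂ u₂ = 0) :
    ∃ C R₀ : ℝ, 1 ≤ R₀ ∧ ∀ h : ℝ, 0 ≤ h → ∀ ρ : ℝ, R₀ ≤ ρ →
      ∀ X P₁ P₂ : Finset (EuclideanSpace ℝ (Fin 3)),
      (∀ p ∈ X, ∀ q ∈ X, p ≠ q → 1 ≤ dist p q) → P₁ ⊆ X → P₂ ⊆ X \ P₁ →
      (∀ p ∈ X, -(2 * R₀) ≤ p 2 ∧ p 2 ≤ h + 2 * R₀ ∧ p 0 ^ 2 + p 1 ^ 2 ≤ ρ ^ 2) →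
      (∀ p, p ∈ P₁ ↔ (p ∈ (fun q => A₁ q + t₁) '' fccStacking 1 (Real.sqrt (2 / 3)) ∧
        -(2 * R₀) ≤ p 2 ∧ p 2 ≤ -R₀ ∧ p 0 ^ 2 + p 1 ^ 2 ≤ ρ ^ 2)) →
      (∀ p, p ∈ P₂ ↔ (p ∈ (fun q => A₂ q + t₂) '' fccStacking 1 (Real.sqrt (2 / 3)) ∧
        h + R₀ ≤ p 2 ∧ p 2 ≤ h + 2 * R₀ ∧ p 0 ^ 2 + p 1 ^ 2 ≤ ρ ^ 2)) →
      -- CLEAN outer slivers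
      (∀ p ∈ X, p 2 < -(2 * R₀) + 1 → p ∈ (fun q => A₁ q + t₁) '' fccStacking 1 (Real.sqrt (2 / 3))) →
      (∀ p ∈ X, h + 2 * R₀ - 1 < p 2 → p ∈ (fun q => A₂ q + t₂) '' fccStacking 1 (Real.sqrt (2 / 3))) →
      ((((P₁ ×ˢ (X \ P₁)).filter fun pq => dist pq.1 pq.2 = 1).card : ℕ) : ℝ) +
        ((((P₂ ×ˢ ((X \ P₁) \ P₂)).filter fun pq => dist pq.1 pq.2 = 1).card : ℕ) : ℝ) ≤
        contactDeficiency ((X \ P₁) \ P₂) +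
          (Real.sqrt 2 / 4 * ∑ᶠ w ∈ {w ∈ fccStacking 1 (Real.sqrt (2 / 3)) | ‖w‖ = 1},
              |⟪w, A₁.symm (EuclideanSpace.single (2 : Fin 3) (1 : ℝ))⟫_ℝ| +
            Real.sqrt 2 / 4 * ∑ᶠ w ∈ {w ∈ fccStacking 1 (Real.sqrt (2 / 3)) | ‖w‖ = 1},
              |⟪w, A₂.symm (EuclideanSpace.single (2 : Fin 3) (1 : ℝ))⟫_ℝ| -
            (Real.sqrt 2 * |⟪A₁ u₁, EuclideanSpace.single (2 : Fin 3) (1 : ℝ)⟫_ℝ| +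
              Real.sqrt 2 * |⟪A₂ u₂, EuclideanSpace.single (2 : Fin 3) (1 : ℝ)⟫_ℝ|) / 2) * Real.pi * ρ ^ 2 +
          (((((X.filter fun e => e ∈ (fun q => A₁ q + t₁) '' fccStacking 1 (Real.sqrt (2 / 3)) ∧
                e - A₁ u₁ ∈ X ∧ (∀ w ∈ fccSlots, e - A₁ u₁ + A₁ w ∈ X) ∧
                ∃ v ∈ fccSlots, e + A₁ v ∉ X).filter fun e => ∃ n : EuclideanSpace ℝ (Fin 3), ‖n‖ = 1 ∧
              (∀ w ∈ fccSlots, ⟪A₁ w, n⟫_ℝ = 0 ∨ ⟪A₁ w, n⟫_ℝ = Real.sqrt (2 / 3) ∨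
                ⟪A₁ w, n⟫_ℝ = -Real.sqrt (2 / 3)) ∧
              ⟪A₁ u₁, n⟫_ℝ = Real.sqrt (2 / 3) ∧
              (∀ w ∈ fccSlots, ⟪A₁ w, n⟫_ℝ ≤ 0 → e + A₁ w ∈ X) ∧
              (∀ w ∈ fccSlots, 0 < ⟪A₁ w, n⟫_ℝ → e + A₁ w ∉ X ∧ e - A₁ w + (2 * ⟪A₁ w, n⟫_ℝ) • n ∈ X)).card
              : ℕ) : ℝ) +
           ((((X.filter fun e => e ∈ (fun q => A₂ q + t₂) '' fccStacking 1 (Real.sqrt (2 / 3)) ∧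
                e - A₂ u₂ ∈ X ∧ (∀ w ∈ fccSlots, e - A₂ u₂ + A₂ w ∈ X) ∧
                ∃ v ∈ fccSlots, e + A₂ v ∉ X).filter fun e => ∃ n : EuclideanSpace ℝ (Fin 3), ‖n‖ = 1 ∧
              (∀ w ∈ fccSlots, ⟪A₂ w, n⟫_ℝ = 0 ∨ ⟪A₂ w, n⟫_ℝ = Real.sqrt (2 / 3) ∨
                ⟪A₂ w, n⟫_ℝ = -Real.sqrt (2 / 3)) ∧
              ⟪A₂ u₂, n⟫_ℝ = Real.sqrt (2 / 3) ∧
              (∀ w ∈ fccSlots, ⟪A₂ w, n⟫_ℝ ≤ 0 → e + A₂ w ∈ X) ∧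
              (∀ w ∈ fccSlots, 0 < ⟪A₂ w, n⟫_ℝ → e + A₂ w ∉ X ∧ e - A₂ w + (2 * ⟪A₂ w, n⟫_ℝ) • n ∈ X)).card
              : ℕ) : ℝ)) / 2 +
          C * (1 + h) * ρ := by
  classical
  obtain ⟨C, R₀, hR₀, H⟩ := twoSlabAdhesion_chainLedger' hs₀ hcert A₁ t₁ A₂ t₂ hA₁₂ hA₂₁ hu₁ hsteep₁ hu₂ hsteep₂
  refine ⟨C, R₀, hR₀, ?_⟩
  intro h hh ρ hρ X P₁ P₂ hX hP₁X hP₂X hcell hP₁ hP₂ hclean₁ hclean₂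
  have key := H h hh ρ hρ X P₁ P₂ hX hP₁X hP₂X hcell hP₁ hP₂ hclean₁ hclean₂
  -- the degree-11 double tops do not exist for antipodal walk slots
  have hne : A₁ '' fccStacking 1 (Real.sqrt (2 / 3)) ≠ A₂ '' fccStacking 1 (Real.sqrt (2 / 3)) := by
    intro heq
    exact hA₁₂ fun w hw => heq ▸ ⟨w, mem_fcc_of_mem_fccSlots hw, rfl⟩
  have hempty : (X.filter fun e => e ∈ (fun q => A₁ q + t₁) '' fccStacking 1 (Real.sqrt (2 / 3)) ∧
      e ∈ (fun q => A₂ q + t₂) '' fccStacking 1 (Real.sqrt (2 / 3)) ∧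
      (X.filter fun q => dist e q = 1).card = 11 ∧
      (e - A₁ u₁ ∈ X ∧ (∀ w ∈ fccSlots, e - A₁ u₁ + A₁ w ∈ X) ∧ ∃ v ∈ fccSlots, e + A₁ v ∉ X) ∧
      (e - A₂ u₂ ∈ X ∧ (∀ w ∈ fccSlots, e - A₂ u₂ + A₂ w ∈ X) ∧ ∃ v ∈ fccSlots, e + A₂ v ∉ X)).card = 0 := by
    rw [Finset.card_eq_zero, Finset.eq_empty_iff_forall_notMem]
    intro e he
    obtain ⟨-, -, -, h11, ⟨hd₁, hf₁, -⟩, ⟨hd₂, hf₂, -⟩⟩ := mem_filter.1 he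
    have hstar : ∀ (A : EuclideanSpace ℝ (Fin 3) ≃ₗᵢ[ℝ] EuclideanSpace ℝ (Fin 3)) (u : EuclideanSpace ℝ (Fin 3)),
        u ∈ fccSlots → e - A u ∈ X → (∀ w ∈ fccSlots, e - A u + A w ∈ X) →
        ∀ s ∈ fccSlots, ⟪s, u⟫_ℝ < 0 → e + A s ∈ X := by
      intro A u hu hd hf s hs hsu
      exact exit_owns_closedStar A hu hd hf hs (by rwa [LinearIsometryEquiv.inner_map_map])
    have h10 := card_neighbours_le_ten_of_antipodal_stars hX A₁ A₂ hne hu₁ hu₂ hanti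
      (hstar A₁ u₁ hu₁ hd₁ hf₁) (hstar A₂ u₂ hu₂ hd₂ hf₂)
    omega
  rw [hempty] at key
  simpa using key

end Summit.Ventures.Crystal3D.Theorems

end
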